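import Summits.CriticalPhenomena.CardyFormulaZ2.Theorems.CardyIKTransportIKLinearTransportStubRowCFTPRemains
import Summits.CriticalPhenomena.CardyFormulaZ2.Theorems.CardyIKTransportIKLinearTransportSDECore3

/-!
# Stub `stub_CoalescingRowKernel` (A_dyn') — part C: CUT ROWS of the environment

Support file (`--supports stmt-CriticalPhenomena-5076`, registered sub-goal `isCut_pinnedStat_of_cert`).

THE MECHANISM replacing the synchronising-row / 3⁄7 architecture of the wave-1 audit. A row `c` of the
environment `p = (e, Δ)` (a value of the pinned statistic `(eraseMid i, stripDiagram i)`) is a CUT ROW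
(`IsCut i c p`) when the two boundary columns `i`, `i+2` carry one colour `col` on the rows `c-1, c, c+1`,
the left boundary cells at rows `c ± 2` carry the other colour, the row-`c` boundary pair `((i,c), (i+2,c))` is
NOT in the diagram and the pair `((i,c-2), (i,c+2))` IS. It is read from `p` ALONE (not from the middle
column) and it is decisive: in every configuration with this pinned statistic the middle cells
`(i+1, c-1), (i+1, c), (i+1, c+1)` are forced to the colour `¬col` (the `¬col` path from `(i, c-2)` to
`(i, c+2)` must cross the three rows, whose boundary cells are blocked), the flags of the faces of rows
`c-1, c` join cells of different colours only, and — because `(i,c) ≁ (i+2,c)` — every monochromatic strip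
path between boundary cells on one side of row `c` can be rerouted to stay on that side. Consequently the
conditional law of the middle rows ABOVE `c` given the pinned statistic and the middle rows below is a
function of the statistic and of the middle rows `> c` only: the row kernel may IGNORE everything at and
below its last cut row, and the grand coupling of the heat-bath dynamics coalesces from EVERY start one row
after a cut row, with no probability to pay (`…StubCoalescingRowKernel.lean`).

This file: the predicate `IsCut`, its LOCAL CERTIFICATE `IsCutCert i c x` (the boundary pattern together
with the middle colour `¬col` on the rows `c-2 … c+2` OF THE CONFIGURATION ITSELF) and the registered
`isCut_pinnedStat_of_cert : IsCutCert i c x → IsCut i c (pinnedStat i x)` (the straight middle path puts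
`((i,c-2),(i,c+2))` in the strip diagram; the three `col` cells `(i, c-1..c+1)` are walled in by `¬col`
cells, so `((i,c),(i+2,c))` is not), the shift covariance `IsCut i c (pshift m p) ↔ IsCut i (c - m) p` and
the measurability of `{p | IsCut i c p}`. The certificate has positive conditional probability given
everything outside its 13 cells (finite energy), whence the exponential tail of the distance to the last
cut row (`…StubCoalescingRowKernelTail.lean`).
-/

noncomputable section

namespace Summit.CriticalPhenomena.CardyFormulaZ2.Theorems.IKLinearTransport.PinnedDiagramExchange

open scoped Classical MeasureTheory ENNReal symmDiff
open Set MeasureTheory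
open Literature.Probability.Percolation Literature.Probability.LatticeModels

/-! ## The cut predicate and its certificate -/

/-- CUT ROW `c` of the environment `p = (e, Δ)` at the face columns `i, i+1`: boundary colour `col` (that
of `(i, c)`) on both boundary columns at rows `c-1, c, c+1`, colour `¬col` at `(i, c ± 2)`, the row-`c`
boundary pair absent from the diagram and the pair `((i, c-2), (i, c+2))` present. [folklore] -/
def IsCut (i c : ℤ) (p : Obs × Set (Site 2 × Site 2)) : Prop :=
  (∀ y : ℤ, c - 1 ≤ y → y ≤ c + 1 →
    ((![i, y] ∈ p.1.1 ↔ ![i, c] ∈ p.1.1) ∧ (![i + 2, y] ∈ p.1.1 ↔ ![i, c] ∈ p.1.1))) ∧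
  (![i, c - 2] ∈ p.1.1 ↔ ![i, c] ∉ p.1.1) ∧ (![i, c + 2] ∈ p.1.1 ↔ ![i, c] ∉ p.1.1) ∧
  (![i, c], ![i + 2, c]) ∉ p.2 ∧ (![i, c - 2], ![i, c + 2]) ∈ p.2

/-- LOCAL CERTIFICATE of a cut row in a configuration `x`: the boundary pattern of `IsCut` together with the
middle colour `¬col` on the rows `c-2, …, c+2`. [folklore] -/
def IsCutCert (i c : ℤ) (x : Obs) : Prop :=
  (∀ y : ℤ, c - 1 ≤ y → y ≤ c + 1 →
    ((![i, y] ∈ x.1 ↔ ![i, c] ∈ x.1) ∧ (![i + 2, y] ∈ x.1 ↔ ![i, c] ∈ x.1))) ∧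
  (![i, c - 2] ∈ x.1 ↔ ![i, c] ∉ x.1) ∧ (![i, c + 2] ∈ x.1 ↔ ![i, c] ∉ x.1) ∧
  (∀ y : ℤ, c - 2 ≤ y → y ≤ c + 2 → (![i + 1, y] ∈ x.1 ↔ ![i, c] ∉ x.1))

/-! ## Small vector facts -/

/-- Vertical translation of an explicit cell. [folklore] -/
theorem crk_vec_sub (a b m : ℤ) : (![a, b] : Site 2) - ![0, m] = ![a, b - m] := by
  ext j; fin_cases j <;> simp

/-- Boundary cells survive `eraseMid`. [folklore] -/
theorem crk_mem_eraseMid_fst (i : ℤ) (x : Obs) (a y : ℤ) (ha : a ≠ i + 1) :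
    (![a, y] : Site 2) ∈ (eraseMid i x).1 ↔ ![a, y] ∈ x.1 := by
  simp only [eraseMid, mem_setOf_eq, Matrix.cons_val_zero]
  exact ⟨fun h => h.1, fun h => ⟨h, ha⟩⟩

/-- Adjacent cells of the triangulation are at sup-distance one. [folklore] -/
theorem crk_adj_near {A : Set (Site 2)} {u v : Site 2} (h : (cellGraph A).Adj u v) :
    v 1 ≤ u 1 + 1 ∧ u 1 ≤ v 1 + 1 ∧ v 0 ≤ u 0 + 1 ∧ u 0 ≤ v 0 + 1 := by
  have := SDE.grid_adj_near _ ((SDE.cellGraph_adj_iff A u v).1 h)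
  exact ⟨this.1, this.2.1, this.2.2.1, this.2.2.2.1⟩

/-- Horizontal neighbours are adjacent. [folklore] -/
theorem crk_adj_right (A : Set (Site 2)) (a y : ℤ) : (cellGraph A).Adj ![a, y] ![a + 1, y] := by
  rw [SDE.cellGraph_adj_iff, SDE.grid_adj]; simp

/-- Horizontal neighbours are adjacent (leftward). [folklore] -/
theorem crk_adj_left (A : Set (Site 2)) (a y : ℤ) : (cellGraph A).Adj ![a + 1, y] ![a, y] :=
  (crk_adj_right A a y).symm

/-- Vertical neighbours are adjacent. [folklore] -/
theorem crk_adj_up (A : Set (Site 2)) (a y : ℤ) : (cellGraph A).Adj ![a, y] ![a, y + 1] := by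
  rw [SDE.cellGraph_adj_iff, SDE.grid_adj]; simp

/-! ## The certificate certifies -/

/-- The straight middle path: under the certificate, `((i, c-2), (i, c+2))` is in the strip diagram. [folklore] -/
theorem crk_cert_mem_stripDiagram (i c : ℤ) (x : Obs) (h : IsCutCert i c x) :
    ((![i, c - 2], ![i, c + 2]) : Site 2 × Site 2) ∈ stripDiagram i x := by
  obtain ⟨-, hm2, hp2, hmid⟩ := h
  rw [ps_mem_stripDiagram_iff]
  refine ⟨Or.inl (by simp), Or.inl (by simp), ⟨?_, by simp, by simp⟩, ⟨by simp, by simp⟩, ?_⟩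
  · rw [hm2, hp2]
  refine ⟨[![i + 1, c - 2], ![i + 1, c - 2 + 1], ![i + 1, c - 2 + 1 + 1], ![i + 1, c - 2 + 1 + 1 + 1],
    ![i + 1, c - 2 + 1 + 1 + 1 + 1], ![i, c + 2]], ?_, ?_, ?_⟩
  · simp only [List.isChain_cons_cons, List.IsChain.singleton, and_true]
    refine ⟨crk_adj_right _ _ _, crk_adj_up _ _ _, crk_adj_up _ _ _, crk_adj_up _ _ _, crk_adj_up _ _ _, ?_⟩
    have e : (c - 2 + 1 + 1 + 1 + 1 : ℤ) = c + 2 := by ring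
    rw [e]; exact crk_adj_left _ _ _
  · simp
  · intro w hw
    simp only [List.mem_cons, List.not_mem_nil, or_false] at hw
    have key : ∀ y : ℤ, c - 2 ≤ y → y ≤ c + 2 →
        ((![i + 1, y] : Site 2) ∈ x.1 ↔ ![i, c - 2] ∈ x.1) ∧ i ≤ (![i + 1, y] : Site 2) 0 ∧
          (![i + 1, y] : Site 2) 0 ≤ i + 2 := fun y h1 h2 =>
      ⟨by rw [hmid y h1 h2, hm2], by simp, by simp⟩
    rcases hw with rfl | rfl | rfl | rfl | rfl | rfl
    · exact key _ (by omega) (by omega)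
    · exact key _ (by omega) (by omega)
    · exact key _ (by omega) (by omega)
    · exact key _ (by omega) (by omega)
    · exact key _ (by omega) (by omega)
    · exact ⟨by rw [hp2, hm2], by simp, by simp⟩

/-- The wall: under the certificate every monochromatic strip neighbour of one of the three `col` cells
`(i, c-1), (i, c), (i, c+1)` is again one of them. [folklore] -/
theorem crk_cert_closed (i c : ℤ) (x : Obs) (h : IsCutCert i c x) {a b : Site 2}
    (ha : a 0 = i ∧ c - 1 ≤ a 1 ∧ a 1 ≤ c + 1) (hab : (cellGraph x.2).Adj a b)
    (hb : (b ∈ x.1 ↔ ![i, c] ∈ x.1) ∧ i ≤ b 0 ∧ b 0 ≤ i + 2) : b 0 = i ∧ c - 1 ≤ b 1 ∧ b 1 ≤ c + 1 := by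
  obtain ⟨hbd, hm2, hp2, hmid⟩ := h
  obtain ⟨n1, n2, n3, n4⟩ := crk_adj_near hab
  have hb_eq : b = ![b 0, b 1] := (SDE.site2_eta b).symm
  -- a same-colour cell cannot sit where the certificate prescribes the other colour
  have clash : ∀ {v : Site 2}, b = v → (v ∈ x.1 ↔ ![i, c] ∉ x.1) → False := by
    rintro v rfl hv
    have h1 : (![i, c] : Site 2) ∈ x.1 ↔ ![i, c] ∉ x.1 := hb.1.symm.trans hv
    exact iff_not_self h1
  by_cases hb0 : b 0 = i + 1
  · exfalso
    refine clash (v := ![i + 1, b 1]) ?_ (hmid (b 1) (by omega) (by omega))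
    rw [← hb0]; exact hb_eq
  have hb0' : b 0 = i := by omega
  refine ⟨hb0', ?_, ?_⟩
  · by_contra hlt
    have hb1 : b 1 = c - 2 := by omega
    refine clash (v := ![i, c - 2]) ?_ hm2
    rw [← hb0', ← hb1]; exact hb_eq
  · by_contra hlt
    have hb1 : b 1 = c + 2 := by omega
    refine clash (v := ![i, c + 2]) ?_ hp2
    rw [← hb0', ← hb1]; exact hb_eq

/-- Chains from a walled-in cell stay walled in. [folklore] -/
theorem crk_cert_chain_mem (i c : ℤ) (x : Obs) (h : IsCutCert i c x) :
    ∀ (l : List (Site 2)) (a : Site 2), (a 0 = i ∧ c - 1 ≤ a 1 ∧ a 1 ≤ c + 1) →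
      List.IsChain (cellGraph x.2).Adj (a :: l) →
      (∀ w ∈ l, (w ∈ x.1 ↔ ![i, c] ∈ x.1) ∧ i ≤ w 0 ∧ w 0 ≤ i + 2) →
      ∀ w ∈ l, w 0 = i ∧ c - 1 ≤ w 1 ∧ w 1 ≤ c + 1
  | [], _, _, _, _ => by simp
  | b :: l, a, ha, hc, hl => by
    have hab : (cellGraph x.2).Adj a b := (List.isChain_cons_cons.1 hc).1
    have hb : b 0 = i ∧ c - 1 ≤ b 1 ∧ b 1 ≤ c + 1 :=
      crk_cert_closed i c x h ha hab (hl b List.mem_cons_self)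
    intro w hw
    rcases List.mem_cons.1 hw with rfl | hw'
    · exact hb
    · exact crk_cert_chain_mem i c x h l b hb (List.isChain_cons_cons.1 hc).2
        (fun w' hw'' => hl w' (List.mem_cons_of_mem _ hw'')) w hw'

/-- The wall holds: under the certificate, `((i, c), (i+2, c))` is NOT in the strip diagram. [folklore] -/
theorem crk_cert_not_mem_stripDiagram (i c : ℤ) (x : Obs) (h : IsCutCert i c x) :
    ((![i, c], ![i + 2, c]) : Site 2 × Site 2) ∉ stripDiagram i x := by
  intro hmem
  rw [ps_mem_stripDiagram_iff] at hmem
  obtain ⟨-, -, -, -, l, hc, hlast, hl⟩ := hmem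
  have hall := crk_cert_chain_mem i c x h l ![i, c] ⟨by simp, by simp, by simp⟩ hc hl
  -- the last cell of the chain is `(i+2, c)`, which is not walled in
  have hmem_last : (![i, c] :: l).getLast (List.cons_ne_nil _ _) ∈ (![i, c] :: l) := List.getLast_mem _
  rw [hlast] at hmem_last
  rcases List.mem_cons.1 hmem_last with heq | hin
  · have := congrFun heq 0
    simp at this
  · have := (hall _ hin).1
    simp at this

/-- THE CERTIFICATE CERTIFIES (registered sub-goal): the local pattern `IsCutCert i c x` of a configuration
makes `c` a cut row of its pinned statistic. [folklore] -/
theorem isCut_pinnedStat_of_cert : ∀ (i c : ℤ) (x : Obs), IsCutCert i c x → IsCut i c (pinnedStat i x) := by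
  intro i c x h
  have hi : (i : ℤ) ≠ i + 1 := by omega
  have hi2 : (i + 2 : ℤ) ≠ i + 1 := by omega
  refine ⟨fun y hy1 hy2 => ?_, ?_, ?_, crk_cert_not_mem_stripDiagram i c x h, crk_cert_mem_stripDiagram i c x h⟩
  · simp only [pinnedStat, crk_mem_eraseMid_fst i x _ _ hi, crk_mem_eraseMid_fst i x _ _ hi2]
    exact h.1 y hy1 hy2
  · simp only [pinnedStat, crk_mem_eraseMid_fst i x _ _ hi]; exact h.2.1
  · simp only [pinnedStat, crk_mem_eraseMid_fst i x _ _ hi]; exact h.2.2.1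

/-! ## Shift covariance and measurability of the cut predicate -/

/-- Membership of an explicit cell in a shifted configuration. [folklore] -/
theorem crk_mem_vshift_fst (m : ℤ) (e : Obs) (a y : ℤ) :
    (![a, y] : Site 2) ∈ (vshift m e).1 ↔ (![a, y - m] : Site 2) ∈ e.1 := by
  show (![a, y] : Site 2) - ![0, m] ∈ e.1 ↔ _
  rw [crk_vec_sub]

/-- Membership of an explicit pair in a shifted diagram. [folklore] -/
theorem crk_mem_dshift (m : ℤ) (Δ : Set (Site 2 × Site 2)) (a y a' y' : ℤ) :
    ((![a, y], ![a', y']) : Site 2 × Site 2) ∈ dshift m Δ ↔ ((![a, y - m], ![a', y' - m]) : Site 2 × Site 2) ∈ Δ := by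
  simp only [dshift, mem_setOf_eq, crk_vec_sub]

/-- SHIFT COVARIANCE of the cut predicate. [folklore] -/
theorem isCut_pshift (i c m : ℤ) (p : Obs × Set (Site 2 × Site 2)) :
    IsCut i c (pshift m p) ↔ IsCut i (c - m) p := by
  simp only [IsCut, pshift, crk_mem_vshift_fst, crk_mem_dshift]
  have e1 : c - 2 - m = c - m - 2 := by ring
  have e2 : c + 2 - m = c - m + 2 := by ring
  rw [e1, e2]
  refine and_congr ?_ Iff.rfl
  constructor
  · intro hh y hy1 hy2
    have := hh (y + m) (by omega) (by omega)
    rwa [show y + m - m = y by ring] at this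
  · intro hh y hy1 hy2
    exact hh (y - m) (by omega) (by omega)

/-- The cut predicate is measurable in the environment. [folklore] -/
theorem measurable_isCut (i c : ℤ) : Measurable fun p : Obs × Set (Site 2 × Site 2) => IsCut i c p := by
  have hcell : ∀ v : Site 2, Measurable fun p : Obs × Set (Site 2 × Site 2) => v ∈ p.1.1 := fun v =>
    (measurable_set_mem v).comp (measurable_fst.comp measurable_fst)
  have hpair : ∀ q : Site 2 × Site 2, Measurable fun p : Obs × Set (Site 2 × Site 2) => q ∈ p.2 := fun q =>
    (measurable_set_mem q).comp measurable_snd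
  unfold IsCut
  refine (Measurable.forall fun y => Measurable.imp measurable_const (Measurable.imp measurable_const
    (((hcell _).iff (hcell _)).and ((hcell _).iff (hcell _))))).and
    ((((hcell _).iff (hcell _).not)).and ((((hcell _).iff (hcell _).not)).and ((hpair _).not.and (hpair _))))

/-- The set of environments with a cut at `c` is measurable. [folklore] -/
theorem measurableSet_isCut (i c : ℤ) : MeasurableSet {p : Obs × Set (Site 2 × Site 2) | IsCut i c p} :=
  measurableSet_setOf.2 (measurable_isCut i c)

end Summit.CriticalPhenomena.CardyFormulaZ2.Theorems.IKLinearTransport.PinnedDiagramExchange
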